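import Summits.ResolutionOfSingularities.ResolutionOfSingularities.Theorems.HilbertSamuelEliminationSigmaMaxModificationsCorridor3RegularCentresPermissible
import Literature.AlgebraicGeometry.Resolution.AlterationsNormalFormBlowupParts
import Literature.AlgebraicGeometry.Resolution.PermissibleBlowupHilbertSamuel
import Literature.AlgebraicGeometry.Resolution.HilbertSamuelStrata
import HarnessLib

/-!
# [OURS · L1 W4.2] (P1*) surfaces — THE CLOSURE ARGUMENT: strict transforms of closed subsets of the `ν`-stratum stay in the
# `ν`-stratum while `ν` is the maximum (res-L1-w42-plan-1 RULING v3.14-29 (GV) (c1)–(c3); hand (GW) «001 := …SigmaSurfacePhaseClosure»;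
# crux `SigmaMaxModifications` stmt-ResolutionOfSingularities-18506 / conjunct stmt-…-19249; consumers res-L1-type-o1 `surfacePhase`, res-type-067, stub-4 (E8-L))

Prover res-type-001 (gen 8). Helper file `--supports stmt-ResolutionOfSingularities-19249 --as helper`; kernel only, no definitions, no named fact.
OURS (cell res-hironaka, slot W4.2); NOT statements of [Hironaka2017] nor of [CossartJannsenSaito2020]. AI-written; AI review is weaker than
expert review.

## The argument (RULING v3.14-29 (GV), «OWED BY THE MODEL … and CHEAP»)

While `ν` is the MAXIMUM value of `H^N` on a stage, `X(ν) = X(≥ ν)` (maximality; CJS Def. 2.35), and `X(≥ ν)` is CLOSED (CJS Thm. 2.33 /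
Lemma 2.36, tree `Scheme.isClosed_hsStratumGE_…` — a HYPOTHESIS here, discharged by the consumers' `isClosed_hsStratumGE_over_field` /
`CycleInv.isClosed_hsStratumGE`). For a blow-up `π : X′ → X` along `D` and a subset `W ⊆ X(ν)`, the strict transform
`W̃ = closure π⁻¹(W ∖ |D|)` (tree `strictTransformSet π D.support W`, GW (13.19)) is the closure of the ISOMORPHIC image of `W ∖ |D|` — off the
centre `H^N` does not change (tree `IsBlowup.hsFun_eq_of_not_mem_support`) — so `π⁻¹(W ∖ |D|) ⊆ X′(ν) ⊆ X′(≥ ν)`, hence `W̃ ⊆ X′(≥ ν) = X′(ν)`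
as soon as `ν` is still the maximum on `X′` (true after a permissible blow-up in a centre `⊆ X(ν)`: CJS Thm. 3.10, the consumers'
`IsMaximalOrigin.of_isBlowup_of_isPermissible`; a HYPOTHESIS here).

* `hsStratumGE_eq_hsStratum_of_maximal` — `X(≥ ν) = X(ν)` when `ν` is a maximal value; `isClosed_hsStratum_of_maximal`.
* **`preimage_diff_support_subset_hsStratum`**, **`strictTransformSet_subset_hsStratum`** — (c1)/(c3): `π⁻¹(W ∖ |D|) ⊆ X′(ν)` and
  `W̃ ⊆ X′(ν)` for `W ⊆ X(ν)`, `ν` maximal on `X′`, `X′(≥ν)` closed. Along PHASE S / B′: `D_{j+1} = D̃_j ⊆ X_{j+1}(ν)` by induction, and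
  `D̃ ⊆ X′(ν)` at the end.
* `subset_hsStratum_of_subset` — (c2), first half: any `S ⊆ D_j` (e.g. `Sing(D_j)`, the non-n.c. locus `NC(D̃, E)`) lies in `X_j(ν)`.
* **`isPermissible_of_isRegular_of_support_subset_hsStratum`** — (c2), second half: a REGULAR centre (point or curve or `D̃` itself) whose
  support lies in `X(ν)`, on a reduced excellent `X` of dimension `≤ N` with `ν ≠ Φ^{(N)}`, is `X`-PERMISSIBLE (Bennett / CJS Thm. 3.3 — the
  tree's `Helpers.isPermissible_of_isRegular_subscheme_of_support_subset_hsStratum_of_isExcellent`, res-L1-w42-stub-3 p478970, cited by name).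

[OURS · L1 W4.2; AI-written] [cite: CossartJannsenSaito2020, Def. 2.35, Lemma 2.36, Thm. 3.3, Thm. 3.10] [cite: GortzWedhorn2020, (13.19) p. 414]
-/

set_option linter.dupNamespace false

noncomputable section

open CategoryTheory AlgebraicGeometry TopologicalSpace IsLocalRing
open Literature.AlgebraicGeometry.Resolution Literature.RingTheory.HilbertSamuel

namespace Summit.ResolutionOfSingularities.ResolutionOfSingularities.Theorems.SigmaMaxModificationsCorridor3.Sigma.SurfacePhase

universe u

/-! ## §1. `X(≥ ν) = X(ν)` while `ν` is the maximum -/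

/-- **`X(≥ ν) = X(ν)` when `ν` is a MAXIMAL value of `H^N` on `X`** (CJS Def. 2.35: the strata of maximal values).
[cite: CossartJannsenSaito2020, Def. 2.35] -/
theorem hsStratumGE_eq_hsStratum_of_maximal {X : Scheme.{u}} [IsLocallyNoetherian X] (N : ℕ) {ν : ℕ → ℕ}
    (hmax : Maximal (· ∈ Scheme.hsValues X N) ν) : Scheme.hsStratumGE X N ν = Scheme.hsStratum X N ν := by
  ext x
  refine ⟨fun hx => ?_, fun hx => ?_⟩
  · exact le_antisymm (hmax.2 ⟨x, rfl⟩ hx) hx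
  · exact le_of_eq (Eq.symm hx)

/-- Hence `X(ν)` is closed when `ν` is maximal and `X(≥ ν)` is closed (CJS Lemma 2.36). [cite: CossartJannsenSaito2020, Lemma 2.36] -/
theorem isClosed_hsStratum_of_maximal {X : Scheme.{u}} [IsLocallyNoetherian X] (N : ℕ) {ν : ℕ → ℕ}
    (hmax : Maximal (· ∈ Scheme.hsValues X N) ν) (hcl : IsClosed (Scheme.hsStratumGE X N ν)) :
    IsClosed (Scheme.hsStratum X N ν) := by
  rwa [← hsStratumGE_eq_hsStratum_of_maximal N hmax]

/-! ## §2. The closure argument: strict transforms of subsets of `X(ν)` -/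

section Blowup

variable {X X' : Scheme.{u}} [IsLocallyNoetherian X] [IsLocallyNoetherian X'] {π : X' ⟶ X} {D : X.IdealSheafData}

omit [IsLocallyNoetherian X'] in
/-- **Off the centre the stratum is preserved**: for `W ⊆ X(ν)`, `π⁻¹(W ∖ |D|) ⊆ X′(ν)` (`H^N_{X′}(x′) = H^N_X(π x′)` off `|D|`, tree
`IsBlowup.hsFun_eq_of_not_mem_support`). [cite: CossartJannsenSaito2020, Def. 2.28] [cite: StacksProject, Tag 02OS] -/
theorem preimage_diff_support_subset_hsStratum (hπ : IsBlowup π D) (N : ℕ) (ν : ℕ → ℕ) {W : Set X}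
    (hW : W ⊆ Scheme.hsStratum X N ν) :
    π.base ⁻¹' (W \ (D.support : Set X)) ⊆ Scheme.hsStratum X' N ν := by
  rintro x' ⟨hxW, hxD⟩
  show Scheme.hsFun X' N x' = ν
  rw [hπ.hsFun_eq_of_not_mem_support x' hxD N]
  exact hW hxW

/-- **THE CLOSURE ARGUMENT ((c1)/(c3) of RULING v3.14-29 (GV)).** For a blow-up `π : X′ → X` along `D`, a subset `W ⊆ X(ν)`, `ν` a
MAXIMAL value of `H^N` on `X′` and `X′(≥ ν)` closed: the strict transform `W̃ = closure π⁻¹(W ∖ |D|) ⊆ X′(ν)`. (Typical use: `X′ = Bl_C X_j`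
with `C ⊆ X_j(ν)` permissible, so `ν` stays the maximum — CJS Thm. 3.10; `W = D_j ⊆ X_j(ν)` gives `D_{j+1} = D̃_j ⊆ X_{j+1}(ν)`.)
[OURS · L1 W4.2; AI-written] [cite: CossartJannsenSaito2020, Def. 2.35, Lemma 2.36, Thm. 3.10] [cite: GortzWedhorn2020, (13.19) p. 414] -/
theorem strictTransformSet_subset_hsStratum (hπ : IsBlowup π D) (N : ℕ) {ν : ℕ → ℕ}
    (hmax' : Maximal (· ∈ Scheme.hsValues X' N) ν) (hcl' : IsClosed (Scheme.hsStratumGE X' N ν)) {W : Set X}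
    (hW : W ⊆ Scheme.hsStratum X N ν) :
    strictTransformSet π (D.support : Set X) W ⊆ Scheme.hsStratum X' N ν := by
  rw [← hsStratumGE_eq_hsStratum_of_maximal N hmax']
  refine closure_minimal ?_ hcl'
  intro x' hx'
  have h := preimage_diff_support_subset_hsStratum hπ N ν hW hx'
  exact le_of_eq (Eq.symm h)

/-- The same for the pointwise description: a point of `X′` lying in the closure of `π⁻¹(W ∖ |D|)` has `H^N = ν`. [folklore] -/
theorem hsFun_eq_of_mem_strictTransformSet (hπ : IsBlowup π D) (N : ℕ) {ν : ℕ → ℕ}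
    (hmax' : Maximal (· ∈ Scheme.hsValues X' N) ν) (hcl' : IsClosed (Scheme.hsStratumGE X' N ν)) {W : Set X}
    (hW : W ⊆ Scheme.hsStratum X N ν) {x' : X'} (hx' : x' ∈ strictTransformSet π (D.support : Set X) W) :
    Scheme.hsFun X' N x' = ν :=
  strictTransformSet_subset_hsStratum hπ N hmax' hcl' hW hx'

end Blowup

/-! ## §3. (c2): sub-loci and regular centres inside the stratum -/

/-- **(c2), first half**: every subset of a subset of `X(ν)` lies in `X(ν)` — `Sing(D_j) ⊆ D_j ⊆ X_j(ν)`, `NC(D̃, E) ⊆ D̃ ⊆ X′(ν)`, a point or a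
curve of `D_j` — recorded by name for the consumers. [folklore] -/
theorem subset_hsStratum_of_subset {X : Scheme.{u}} [IsLocallyNoetherian X] (N : ℕ) (ν : ℕ → ℕ) {S W : Set X} (hS : S ⊆ W)
    (hW : W ⊆ Scheme.hsStratum X N ν) : S ⊆ Scheme.hsStratum X N ν :=
  hS.trans hW

/-- **(c2), second half — REGULAR CENTRES INSIDE THE STRATUM ARE PERMISSIBLE** (Bennett, CJS Thm. 3.3; the tree's
`Helpers.isPermissible_of_isRegular_subscheme_of_support_subset_hsStratum_of_isExcellent`, res-L1-w42-stub-3, cited by name): on a reduced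
excellent `X` of dimension `≤ N`, for a stratum `ν ≠ Φ^{(N)}`, a centre `C` with `C.subscheme` regular and `|C| ⊆ X(ν)` is permissible —
the PHASE S / B′ point centres, the regular curve centres inside `Sing(D_j)` or `NC(D̃, E)`, and `D̃` itself once regular.
[cite: CossartJannsenSaito2020, Thm. 3.3, Def. 3.1] -/
theorem isPermissible_of_isRegular_of_support_subset_hsStratum {X : Scheme.{u}} [IsLocallyNoetherian X] [IsReduced X]
    (hexc : Scheme.IsExcellent X) {N : ℕ} (hdim : topologicalKrullDim X ≤ (N : WithBot ℕ∞)) {ν : ℕ → ℕ}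
    (hν : ν ≠ iterPSum N Phi) (C : X.IdealSheafData) (hreg : Scheme.IsRegular C.subscheme)
    {W : Set X} (hW : W ⊆ Scheme.hsStratum X N ν) (hC : (C.support : Set X) ⊆ W) :
    IdealSheafData.IsPermissible C :=
  Helpers.isPermissible_of_isRegular_subscheme_of_support_subset_hsStratum_of_isExcellent hexc hdim hν C hreg (hC.trans hW)

end Summit.ResolutionOfSingularities.ResolutionOfSingularities.Theorems.SigmaMaxModificationsCorridor3.Sigma.SurfacePhase

end
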